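import Mathlib
import Summits.ResolutionOfSingularities.ResolutionOfSingularities.Theorems.WildQuotientsWildQuotientResolutionJordanThreeOneBlowup
import Summits.ResolutionOfSingularities.ResolutionOfSingularities.Theorems.WildQuotientsWildQuotientResolutionJordanThreeChartB2a
import Summits.ResolutionOfSingularities.ResolutionOfSingularities.Theorems.WildQuotientsWildQuotientResolutionJordanThreeChartsB

/-!
# Rung V3 (one blow-up model): `Bl_{K₃} 𝔸ⁿ` is regular, integral, and proper birational over `𝔸ⁿ`

(crux stmt-ResolutionOfSingularities-15640 `WildQuotients.WildQuotientResolution`, line `Sketch`,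
sector `|G| = p`; rung V3 of `L/w45c/CHAIN.md` v4, ONE-BLOW-UP design of record (lead-1 RULING
2026-08-27T01:07:58Z); part (c) of stub-4's split, UNCONDITIONAL: `k3_blowup_regular_of_charts`
(`…JordanThreeOneBlowup`) fed with the four Newton-vertex charts — `isRegularRing_chartRing_k3_zero`
(A, `…JordanThreeChartsA`), `isRegularRing_chartRing_k3_one` (B2a, `…JordanThreeChartB2a`) [stub-4],
`isRegularRing_chartRing_k3_B2b`, `isRegularRing_chartRing_k3_B1` (`…JordanThreeChartsB`, p482519)
[stub-2]. [OURS · L1 W4.5c] — NOT a statement of any manuscript; replaces the role of no printed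
item.)

`K₃ = (x_a⁴, x_a³x_b, x_a²x_b³, x_a x_b⁴, x_b⁶) ⊆ k[x₁,…,xₙ]`, `a ≠ b`, any field `k`: its blow-up is
the smooth toric modification of the `(x_a, x_b)`-plane by the fan refining the quadrant by the rays
`(1,1), (2,1), (3,2)` (times `𝔸ⁿ⁻²`) — the composite of the three plain blow-ups of the `J₃` tower
(CRUX-PLAN v4 §V3.1) in one step. This is the `(V, π)`-half of the terminal model consumed by
`JordanThree.v3_hasResolution_of_model` (p479205); the action half (`liftAction` via
`idealSheaf_k3_comap`, p482025, `hcov`, `hdiv`) is lead-1's assembly.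
-/

-- single-problem summit: the doubled namespace component `ResolutionOfSingularities` is forced
set_option linter.dupNamespace false

noncomputable section

open MvPolynomial AlgebraicGeometry CategoryTheory
open Literature.AlgebraicGeometry.Resolution

namespace Summit.ResolutionOfSingularities.ResolutionOfSingularities.Theorems.WildQuotientResolution.JordanThree

/-- **`Bl_{K₃} 𝔸ⁿ` is a regular integral scheme, proper and birational over `𝔸ⁿ`** (`a ≠ b`, any
field `k`, any `n`): regularity by the four polynomial charts A, B2a, B2b, B1 (the fifth chart lies in
B2a), integrality and birationality since `K₃ ≠ 0`, properness since `k[x]` is Noetherian.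
[OURS · L1 W4.5c] [folklore: smooth toric surfaces] -/
theorem k3_blowup_regular (k : Type) [Field k] (n : ℕ) (a b : Fin n) (hab : a ≠ b) :
    Scheme.IsRegular (affineBlowup (Ideal.span (Set.range
        (![X a ^ 4, X a ^ 3 * X b, X a ^ 2 * X b ^ 3, X a * X b ^ 4, X b ^ 6] :
          Fin 5 → MvPolynomial (Fin n) k)))) ∧
      IsIntegral (affineBlowup (Ideal.span (Set.range
        (![X a ^ 4, X a ^ 3 * X b, X a ^ 2 * X b ^ 3, X a * X b ^ 4, X b ^ 6] :
          Fin 5 → MvPolynomial (Fin n) k)))) ∧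
      IsProper (affineBlowup.π (Ideal.span (Set.range
        (![X a ^ 4, X a ^ 3 * X b, X a ^ 2 * X b ^ 3, X a * X b ^ 4, X b ^ 6] :
          Fin 5 → MvPolynomial (Fin n) k)))) ∧
      IsBirational (affineBlowup.π (Ideal.span (Set.range
        (![X a ^ 4, X a ^ 3 * X b, X a ^ 2 * X b ^ 3, X a * X b ^ 4, X b ^ 6] :
          Fin 5 → MvPolynomial (Fin n) k)))) :=
  k3_blowup_regular_of_charts k n a b (isRegularRing_chartRing_k3_zero k n a b hab)
    (isRegularRing_chartRing_k3_one k n a b hab) (isRegularRing_chartRing_k3_B2b k n a b hab)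
    (isRegularRing_chartRing_k3_B1 k n a b hab)

end Summit.ResolutionOfSingularities.ResolutionOfSingularities.Theorems.WildQuotientResolution.JordanThree

end
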